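import Literature.MathematicalPhysics.QuantumFieldTheory.Balaban1983to89.B12RegularSpaces111
import Literature.MathematicalPhysics.QuantumFieldTheory.Balaban1983to89.B11Eq120SolutionLipschitz
import Literature.MathematicalPhysics.QuantumFieldTheory.Balaban1983to89.B11Eq115Space

/-!
# `Balaban1983to89.B12Lemma4ChartSizes` — T. Bałaban, *Renormalization group approach to lattice gauge field theories. I*,
Commun. Math. Phys. **109** (1987) 249–301 [Balaban1987RG1], §3 pp. 277–280: the three SIZE INPUTS «by reference to [15]» of the
proof of Lemma 4 (p. 280) — **(3.37)**, **(3.45)** and **(3.50)** — DERIVED for the Landau-gauge chart of [15] =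
[Balaban1985Variational] Sect. G as the tree holds it (`B11Eq174Chart.chartH`, a Lean function over the contraction scheme
`B11Prop6Scheme`), in the LITERAL hypothesis shapes `hH`/`hHd`/`hK`/`hKd`, `h45`/`h45τ`, `hA`/`hAd` of
`B12Lemma4ConcreteFrame.JInputs` (the by-reference package of `B12Lemma4ConcreteFrame.lemma4Printed_frameOf`).

HONEST FRAMING: statement-level skeleton of published theorems with citation tags; proofs where landed; one finite torus at a time;
nothing here is a claim about the continuum limit, ℝ⁴, the OS axioms, a mass gap or the Clay problem.  Track-A node N09 (pub-ymgap,
HUMAN RULING D-0062): count-neutral section module; NOT a node discharge.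

THE PRINT, verbatim (PDF held `paper:balaban1987-cmp109-rg-i-small-field`, journal page = PDF page + 248; transcript
`pub-balaban/b2b-balaban-b03/B12s-transcript.md` ll. 383–431, render-read).
* p. 277 [29], (3.37): *«At first let us take 𝐀 = 0. We have U_j(□₀, exp iτQ(L⁻¹η𝐇_{k+1})) = (exp iξ𝐇_j(□₀, τQ(L⁻¹η𝐇_{k+1})))^{u_j};
  |𝐇_j(□₀, τQ(…))|, |∇^ξ𝐇_j(□₀, τQ(…))| < B₃²O(1)Mα₀L^{j−1}η on □̃³; |u_j − 1| < B₃²O(1)Mα₀.»* — with (3.27) p. 275 *«|𝐇_{k+1}(□₀,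
  (1/i) log V)|, |∇^{L⁻¹η}𝐇_{k+1}(□₀, (1/i) log V)|, ‖𝐇_{k+1}(□₀, (1/i) log V)‖_{1,β} < B₃O(1)Mα₀ on □̃⁴»* and (97) [12] for `Q`.
* p. 279 [31], (3.45): *«Furthermore, the function 𝐇_j is given by (174) [15], i.e. 𝐇_j(□₀, B) = H_{1,j}B + 𝐀_{1,j}(B) − H_jD_j(H_{1,j}B +
  𝐀_{1,j}(B)), where the functions on the right-hand side are at least of second order, except the first term. This implies
  |∂^ξ𝐇_j(□₀, Q(L⁻¹η𝐇_{k+1})) − ∂^ξH_{1,j}Q(L⁻¹η𝐇_{k+1})| < B₃(B₃O(1)Mα₀L^{j−1}η)² < βα₀(L^{j−1}η)² on □̃³.»*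
* pp. 279–280 [31–32], (3.50): *«𝐇_j(□₀, τQ(L⁻¹η𝐇_{k+1}) + B′) = 𝐇_j(□₀, τQ(L⁻¹η𝐇_{k+1})) + ∫₀¹ dt₂ ⟨(δ/δB 𝐇_j)(□₀, τQ(L⁻¹η𝐇_{k+1}) +
  t₂B′), B′⟩ = 𝐇_j(□₀, τQ(L⁻¹η𝐇_{k+1})) + 𝐀₂, (3.50) where the last equality is a definition of 𝐀₂. It implies |𝐀₂|, |∇^ξ𝐀₂| ≤ B₃|B′|
  < B₃α₃»*.
* [15] = [Balaban1985Variational] CMP **102** (1985), p. 305 (174)–(175), p. 306 (176)–(177) *«the expansion of 𝓗 begins with the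
  first order term H₁B»*, Prop. 6 p. 295 (the contraction (120)), Prop. 9 p. 309 — in the tree BY NAME: `B11Eq174Chart.Regime`
  (the scheme's hypotheses (117)–(121)), `Regime.norm_chartH_le` ((173)/(3.27): `‖𝓗(𝔄)‖ ≤ K(ε₄ + ‖𝔄‖)`),
  `Regime.norm_chartH_sub_self_le` ((177): `‖𝓗(𝔄) − 𝔄‖ ≤ (K_D + B₀C₄)(ε₄ + a)²`),
  `B11Eq120SolutionLipschitz.norm_chartH_sub_chartH_le_datum` (the chart is `K(κ/(1−κ)+1)`-Lipschitz in the datum).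

WHAT THIS MODULE PROVES (theorems only, no `def`, no new `Prop`; 0 sorry; axioms standard).  SETTING: the chart
`𝓗 := chartH 𝒢 0 W 0 T ε₄ : 𝒴 → 𝒴` of (174) (no linear term, no current: Λ = 0, J = 0) under a regime
`R : Regime 𝒢 0 W B₀ θ C₄ a₃ jc a ε₄`, the Landau map `T` with `T 0 = 0`, `K`-Lipschitz on the ball of radius `ε₄ + a` and (for (3.45))
of second order (`‖T Y − Y‖ ≤ K_D‖Y‖²`); a PRESENTATION of the abstract space `𝒴` (the configurations with the norm (115) of [15]) as
`𝔸`-valued bond functions of the lattice `T^{(i)}` of `Setup` — a ℂ-linear `ev : 𝒴 →ₗ[ℂ] (PBond P i → 𝔸)` whose letters and whose plain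
`ξ`-gradients (`B12RegularSpaces111.grad`, (1.12)) are dominated by the norm: `‖ev Y b‖ ≤ ‖Y‖`, `‖∇^ξ_μ (ev Y)(·, ν)(y)‖ ≤ ‖Y‖` (the
norm (115) is the max of the scaled sup-norms of the configuration and of its first covariant derivatives — this domination is the
content of the presentation, a HYPOTHESIS here); a datum `𝔄 ∈ 𝒴` (print: `H_{1,j}Q(L⁻¹η𝐇_{k+1})`) with `‖𝔄‖ < a`, `τ ∈ [0, 1]`.
* §1 lattice algebra [folklore]: the plaquette combination `ξ⁻¹(F(x,μ) + F(x+e_μ,ν) − F(x+e_ν,μ) − F(x,ν))` of `JInputs.h45` IS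
  `∇^ξ_μ F(·,ν)(x) − ∇^ξ_ν F(·,μ)(x)` (`curl_eq_grad_sub`), hence dominated by `2‖Y‖` for presented `F = ev Y` (`norm_curl_ev_le`).
* §2 **(3.37)**: `‖𝓗(τ𝔄)‖ ≤ K(ε₄ + τ‖𝔄‖)` (`norm_chartH_smul_le`); the letters and gradients of `𝐊_τ := ev 𝓗(τ𝔄)` are `< K(ε₄ + a)`
  (`norm_ev_chartH_smul_lt`, `norm_grad_ev_chartH_smul_lt`), hence `< B₃²O₁Mα₀(L^{j−1}η)` whenever `K(ε₄ + a) ≤ B₃²O₁Mα₀(L^{j−1}η)`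
  — the shapes `hK`/`hKd` (every `τ ∈ [0,1]`) and `hH`/`hHd` (`τ = 1`) of `JInputs` (`ineq337_letter`, `ineq337_grad`,
  `ineq337_letter_one`, `ineq337_grad_one`); and the two-chart composition of p. 277 — the datum `𝔄 = H₁(Q(c • 𝓗′(𝔄′)))` built from a
  second chart value with `‖𝓗′(𝔄′)‖ ≤ K′(ε₄′ + a′)` ((3.27)), a bounded `Q` ((97) [12]) and the scale `c = L⁻¹η` has
  `‖𝔄‖ ≤ ‖H₁‖‖Q‖|c|K′(ε₄′ + a′)` (`norm_datum_le_of_chart`).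
* §3 **(3.45)** from (177): with `ℓ p := ξ⁻¹(curl of ev 𝔄 at p)` (print: `∂^ξH_{1,j}Q(…)`),
  `‖ξ⁻¹(curl of 𝐊_τ at p) − τℓ p‖ ≤ 2(K_D + B₀C₄)(ε₄ + a)²` (`norm_curl_chartH_sub_lin_le`), hence the shape `h45τ` (and `h45` at
  `τ = 1`) of `JInputs` whenever `2(K_D + B₀C₄)(ε₄ + a)² < B₃(B₃O₁Mα₀(L^{j−1}η))²` (`ineq345_tau`, `ineq345_one`).
* §4 **(3.50)** from the Lipschitz dependence of the chart on its datum: for a base datum `𝔄₀` and an increment `𝔄′` with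
  `‖𝔄₀‖, ‖𝔄₀ + 𝔄′‖ < a`, `𝐀₂ := ev(𝓗(𝔄₀ + 𝔄′) − 𝓗(𝔄₀))` satisfies `ev 𝓗(𝔄₀ + 𝔄′) = ev 𝓗(𝔄₀) + 𝐀₂` (`eq350`) and
  `‖𝐀₂ b‖, ‖∇^ξ_μ 𝐀₂(·,ν)(y)‖ ≤ K(κ/(1 − κ) + 1)‖𝔄′‖`, `κ = θ + 4B₀C₄(ε₄ + a)` (`norm_A2_le`, `norm_grad_A2_le`); with `𝔄′ = H₁B′`,
  `‖B′‖ ≤ n` and `K(κ/(1 − κ) + 1)‖H₁‖ ≤ B₃` the shapes `hA`/`hAd` of `JInputs`: `‖𝐀₂ b‖, ‖∇𝐀₂‖ ≤ B₃ n` (`ineq350_letter`, `ineq350_grad`).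
WHAT IS *NOT* HERE.  The identification of print's constants (`B₃²O(1)M`, `L^{j−1}η` = the (115)-weights at `ξ = L^{−j}`) with the
scheme's letters is recorded only as the explicit arithmetic hypotheses above (print does not display it either: «by (174) [15]»,
«Of course we have used also the exponential decay properties»); the gauge-transformation cost `|u_j − 1| < B₃²O(1)Mα₀` of (3.37), the
identities (3.38)/(3.39)/(3.42) and the `J`-inputs (J2)/(J3) of `JInputs` are untouched (they are [12]/[14]/[15] statements of other
kinds); no `Lemma4Data` package is built here.  Unit `pub-ymgap-dag-n09-b` (prover, -b FIRST-MISSING-ESTIMATE seat of node N09,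
D-0062), HOME `run/shared/lean/pub/pub-ymgap/`.
v2 (same unit, append-only): §5 — the same eight shapes with the presentation's domination, and the conclusions, LOCALISED to a
bond set `S` / site set `S₀` (print's *«on □̃³»*: for the (115)-norm the domination holds with constant 1 on the top level only);
§6 — the presentation of record: the jet space `B11Eq115Space.JetSup w₀ w₁ D` (the (115) norm as a genuine normed space) read as bond
functions SATISFIES §5's localised domination hypotheses wherever the weights are `≥ 1` (`jet_letter_dominated_on`,
`jet_grad_dominated_on`; top level: `levWeight_eq_one_of_top`).
-/

noncomputable section

namespace Literature.MathematicalPhysics.QuantumFieldTheory.Balaban1983to89.B12Lemma4ChartSizes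

open B11Prop6Scheme (norm_arg_lt)
open B11Eq174Chart (Regime solA chartH chartH_def)
open B11Eq120SolutionLipschitz (norm_chartH_sub_chartH_le_datum)
open B12RegularSpaces111 (grad)

variable {P : Params} {i : ℕ} {𝔸 : Type*} [NormedRing 𝔸] [NormedAlgebra ℂ 𝔸]
variable {𝒴 𝒵 𝒳 : Type*} [NormedAddCommGroup 𝒴] [NormedSpace ℂ 𝒴] [NormedAddCommGroup 𝒵] [NormedSpace ℂ 𝒵]
  [NormedAddCommGroup 𝒳] [NormedSpace ℂ 𝒳]

/-! ## §1. Lattice algebra: the plaquette combination of `JInputs.h45` is a difference of two plain gradients -/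

/-- The plaquette combination `ξ⁻¹(F(x, x+e_μ) + F(x+e_μ, ν) − F(x+e_ν, μ) − F(x, ν))` (the linearised plaquette variable, the left
member of (3.45) before subtracting the linear part; print's `∂^ξ𝐇` on a plaquette, (3.43)) equals `∇^ξ_μ F(·, ν)(x) − ∇^ξ_ν F(·, μ)(x)`
with the plain gradient (1.12) — the lattice curl. [cite: Balaban1987RG1, (3.43) p.278 and (1.12) p.262] -/
theorem curl_eq_grad_sub (ξ : ℝ) (F : PBond P i → 𝔸) (p : Plaq P i) :
    (ξ : ℂ)⁻¹ • (F ⟨p.src, p.μ⟩ + F ⟨p.src.shift p.μ, p.ν⟩ - F ⟨p.src.shift p.ν, p.μ⟩ - F ⟨p.src, p.ν⟩) =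
      grad ξ p.μ (fun z => F ⟨z, p.ν⟩) p.src - grad ξ p.ν (fun z => F ⟨z, p.μ⟩) p.src := by
  simp only [grad, ← smul_sub]
  congr 1
  abel

/-- The plaquette combination is additive in the bond function. [folklore] -/
private theorem curl_sub (ξ : ℝ) (F G : PBond P i → 𝔸) (p : Plaq P i) :
    (ξ : ℂ)⁻¹ • ((F - G) ⟨p.src, p.μ⟩ + (F - G) ⟨p.src.shift p.μ, p.ν⟩ - (F - G) ⟨p.src.shift p.ν, p.μ⟩ - (F - G) ⟨p.src, p.ν⟩) =
      (ξ : ℂ)⁻¹ • (F ⟨p.src, p.μ⟩ + F ⟨p.src.shift p.μ, p.ν⟩ - F ⟨p.src.shift p.ν, p.μ⟩ - F ⟨p.src, p.ν⟩) -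
        (ξ : ℂ)⁻¹ • (G ⟨p.src, p.μ⟩ + G ⟨p.src.shift p.μ, p.ν⟩ - G ⟨p.src.shift p.ν, p.μ⟩ - G ⟨p.src, p.ν⟩) := by
  simp only [Pi.sub_apply, ← smul_sub]
  congr 1
  abel

/-- The plaquette combination commutes with scalars. [folklore] -/
private theorem curl_smul (ξ : ℝ) (t : ℂ) (G : PBond P i → 𝔸) (p : Plaq P i) :
    (ξ : ℂ)⁻¹ • ((t • G) ⟨p.src, p.μ⟩ + (t • G) ⟨p.src.shift p.μ, p.ν⟩ - (t • G) ⟨p.src.shift p.ν, p.μ⟩ - (t • G) ⟨p.src, p.ν⟩) =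
      t • ((ξ : ℂ)⁻¹ • (G ⟨p.src, p.μ⟩ + G ⟨p.src.shift p.μ, p.ν⟩ - G ⟨p.src.shift p.ν, p.μ⟩ - G ⟨p.src, p.ν⟩)) := by
  simp only [Pi.smul_apply, ← smul_add, ← smul_sub]
  rw [smul_comm]

/-- For a presentation `ev` whose `ξ`-gradients are dominated by the norm of `𝒴`, the plaquette combination of a presented
configuration is dominated by twice the norm. [folklore] -/
private theorem norm_curl_ev_le {ξ : ℝ} (ev : 𝒴 →ₗ[ℂ] (PBond P i → 𝔸))
    (hev₁ : ∀ (Y : 𝒴) (μ ν : Fin P.d) (y : Site P i), ‖grad ξ μ (fun z => ev Y ⟨z, ν⟩) y‖ ≤ ‖Y‖) (Y : 𝒴) (p : Plaq P i) :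
    ‖(ξ : ℂ)⁻¹ • (ev Y ⟨p.src, p.μ⟩ + ev Y ⟨p.src.shift p.μ, p.ν⟩ - ev Y ⟨p.src.shift p.ν, p.μ⟩ - ev Y ⟨p.src, p.ν⟩)‖ ≤
      2 * ‖Y‖ := by
  rw [curl_eq_grad_sub]
  refine (norm_sub_le _ _).trans ?_
  have h1 := hev₁ Y p.μ p.ν p.src
  have h2 := hev₁ Y p.ν p.μ p.src
  linarith

/-! ## §2. (3.37) p. 277: the sizes of `𝐇_j(□₀, τQ(L⁻¹η𝐇_{k+1}))` from the chart bound of [15] -/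

section Chart

variable [CompleteSpace 𝒴] {𝒢 : 𝒵 →L[ℂ] 𝒴} {W : 𝒴 → 𝒵} {T : 𝒴 → 𝒴} {B₀ θ C₄ a₃ jc a ε₄ : ℝ}

omit [CompleteSpace 𝒴] in
/-- The norm of a real multiple `τ𝔄`, `0 ≤ τ`: `‖τ𝔄‖ = τ‖𝔄‖`. [folklore] -/
private theorem norm_real_smul_eq {τ : ℝ} (hτ0 : 0 ≤ τ) (𝔄 : 𝒴) : ‖(τ : ℂ) • 𝔄‖ = τ * ‖𝔄‖ := by
  rw [norm_smul, Complex.norm_real, Real.norm_eq_abs, abs_of_nonneg hτ0]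

omit [CompleteSpace 𝒴] in
/-- A datum scaled by `τ ∈ [0, 1]` stays in the open ball of radius `a` ((3.46)→(3.47): «it is valid also for this expression
replaced by τQ(…), τ ∈ [0,1]»). [cite: Balaban1987RG1, p.279 after (3.46)] -/
private theorem norm_real_smul_lt {τ : ℝ} (hτ0 : 0 ≤ τ) (hτ1 : τ ≤ 1) {𝔄 : 𝒴} (h𝔄 : ‖𝔄‖ < a) : ‖(τ : ℂ) • 𝔄‖ < a := by
  rw [norm_real_smul_eq hτ0]
  have h0 : 0 ≤ ‖𝔄‖ := norm_nonneg _
  nlinarith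

/-- **(3.37), chart form**: under the contraction regime of [15] Prop. 6 with no current and no linear term, for the Landau map `T`
with `T 0 = 0`, `K`-Lipschitz on the ball of radius `ε₄ + a`, the chart at the scaled datum `τ𝔄` (`τ ∈ [0,1]`, `‖𝔄‖ < a`) obeys
`‖𝓗(τ𝔄)‖ ≤ K(ε₄ + τ‖𝔄‖)` — [15] (173)/Prop. 9 in norm form (`Regime.norm_chartH_le`) at the datum of (3.37).
[cite: Balaban1987RG1, (3.37) p.277] [cite: Balaban1985Variational, Prop. 9 p.309] -/
theorem norm_chartH_smul_le (R : Regime 𝒢 0 W B₀ θ C₄ a₃ jc a ε₄) (hjc : 0 ≤ jc) {𝔄 : 𝒴} (h𝔄 : ‖𝔄‖ < a)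
    {τ : ℝ} (hτ0 : 0 ≤ τ) (hτ1 : τ ≤ 1) {K : ℝ} (hK : 0 ≤ K) (hT0 : T 0 = 0)
    (hT : ∀ x y : 𝒴, ‖x‖ < ε₄ + a → ‖y‖ < ε₄ + a → ‖T x - T y‖ ≤ K * ‖x - y‖) :
    ‖chartH 𝒢 0 W 0 T ε₄ ((τ : ℂ) • 𝔄)‖ ≤ K * (ε₄ + τ * ‖𝔄‖) := by
  have hJ : ‖(0 : 𝒵)‖ ≤ jc := by simpa using hjc
  have h := (R.norm_chartH_le (J := 0) (T := T) hJ (norm_real_smul_lt hτ0 hτ1 h𝔄) hK hT0 hT).2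
  rwa [norm_real_smul_eq hτ0] at h

/-- **(3.37), strict chart form**: `‖𝓗(τ𝔄)‖ < K(ε₄ + a)` for `K > 0`, `τ ∈ [0,1]`, `‖𝔄‖ < a`. [cite: Balaban1987RG1, (3.37) p.277] -/
theorem norm_chartH_smul_lt (R : Regime 𝒢 0 W B₀ θ C₄ a₃ jc a ε₄) (hjc : 0 ≤ jc) {𝔄 : 𝒴} (h𝔄 : ‖𝔄‖ < a)
    {τ : ℝ} (hτ0 : 0 ≤ τ) (hτ1 : τ ≤ 1) {K : ℝ} (hK : 0 < K) (hT0 : T 0 = 0)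
    (hT : ∀ x y : 𝒴, ‖x‖ < ε₄ + a → ‖y‖ < ε₄ + a → ‖T x - T y‖ ≤ K * ‖x - y‖) :
    ‖chartH 𝒢 0 W 0 T ε₄ ((τ : ℂ) • 𝔄)‖ < K * (ε₄ + a) := by
  refine (norm_chartH_smul_le R hjc h𝔄 hτ0 hτ1 hK.le hT0 hT).trans_lt ?_
  have h0 : 0 ≤ ‖𝔄‖ := norm_nonneg _
  have hτa : τ * ‖𝔄‖ < a := by nlinarith
  nlinarith

variable (ev : 𝒴 →ₗ[ℂ] (PBond P i → 𝔸)) {ξ : ℝ}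

/-- **(3.37), letters**: every bond value of the presented chart `𝐊_τ = ev 𝓗(τ𝔄)` is `< K(ε₄ + a)`.
[cite: Balaban1987RG1, (3.37) p.277] -/
theorem norm_ev_chartH_smul_lt (hev₀ : ∀ (Y : 𝒴) (b : PBond P i), ‖ev Y b‖ ≤ ‖Y‖)
    (R : Regime 𝒢 0 W B₀ θ C₄ a₃ jc a ε₄) (hjc : 0 ≤ jc) {𝔄 : 𝒴} (h𝔄 : ‖𝔄‖ < a)
    {τ : ℝ} (hτ0 : 0 ≤ τ) (hτ1 : τ ≤ 1) {K : ℝ} (hK : 0 < K) (hT0 : T 0 = 0)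
    (hT : ∀ x y : 𝒴, ‖x‖ < ε₄ + a → ‖y‖ < ε₄ + a → ‖T x - T y‖ ≤ K * ‖x - y‖) (b : PBond P i) :
    ‖ev (chartH 𝒢 0 W 0 T ε₄ ((τ : ℂ) • 𝔄)) b‖ < K * (ε₄ + a) :=
  (hev₀ _ b).trans_lt (norm_chartH_smul_lt R hjc h𝔄 hτ0 hτ1 hK hT0 hT)

/-- **(3.37), gradients**: every plain `ξ`-gradient of the presented chart `𝐊_τ` is `< K(ε₄ + a)`.
[cite: Balaban1987RG1, (3.37) p.277] -/
theorem norm_grad_ev_chartH_smul_lt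
    (hev₁ : ∀ (Y : 𝒴) (μ ν : Fin P.d) (y : Site P i), ‖grad ξ μ (fun z => ev Y ⟨z, ν⟩) y‖ ≤ ‖Y‖)
    (R : Regime 𝒢 0 W B₀ θ C₄ a₃ jc a ε₄) (hjc : 0 ≤ jc) {𝔄 : 𝒴} (h𝔄 : ‖𝔄‖ < a)
    {τ : ℝ} (hτ0 : 0 ≤ τ) (hτ1 : τ ≤ 1) {K : ℝ} (hK : 0 < K) (hT0 : T 0 = 0)
    (hT : ∀ x y : 𝒴, ‖x‖ < ε₄ + a → ‖y‖ < ε₄ + a → ‖T x - T y‖ ≤ K * ‖x - y‖) (μ ν : Fin P.d) (y : Site P i) :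
    ‖grad ξ μ (fun z => ev (chartH 𝒢 0 W 0 T ε₄ ((τ : ℂ) • 𝔄)) ⟨z, ν⟩) y‖ < K * (ε₄ + a) :=
  (hev₁ _ μ ν y).trans_lt (norm_chartH_smul_lt R hjc h𝔄 hτ0 hτ1 hK hT0 hT)

/-- **(3.37) in the shape `JInputs.hK`** — *«|𝐇_j(□₀, τQ(…))| < B₃²O(1)Mα₀L^{j−1}η on □̃³»*: for every bond,
`‖𝐊_τ b‖ < B₃²O₁Mα₀(L^{j−1}η)` once the chart constant satisfies `K(ε₄ + a) ≤ B₃²O₁Mα₀(L^{j−1}η)` (the arithmetic behind print's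
constant: the regime radius `a` is the size of the datum `H_{1,j}τQ(L⁻¹η𝐇_{k+1})`, of order `B₃O(1)Mα₀·L⁻¹η` by (3.27) and (97) [12],
and `ε₄ ≤ a`). [cite: Balaban1987RG1, (3.37) p.277] -/
theorem ineq337_letter (hev₀ : ∀ (Y : 𝒴) (b : PBond P i), ‖ev Y b‖ ≤ ‖Y‖)
    (R : Regime 𝒢 0 W B₀ θ C₄ a₃ jc a ε₄) (hjc : 0 ≤ jc) {𝔄 : 𝒴} (h𝔄 : ‖𝔄‖ < a)
    {τ : ℝ} (hτ0 : 0 ≤ τ) (hτ1 : τ ≤ 1) {K : ℝ} (hK : 0 < K) (hT0 : T 0 = 0)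
    (hT : ∀ x y : 𝒴, ‖x‖ < ε₄ + a → ‖y‖ < ε₄ + a → ‖T x - T y‖ ≤ K * ‖x - y‖)
    {B₃ O₁ M α₀ L η : ℝ} {j : ℕ} (hsize : K * (ε₄ + a) ≤ B₃ ^ 2 * O₁ * M * α₀ * (L ^ (j - 1) * η)) :
    ∀ b : PBond P i, ‖ev (chartH 𝒢 0 W 0 T ε₄ ((τ : ℂ) • 𝔄)) b‖ < B₃ ^ 2 * O₁ * M * α₀ * (L ^ (j - 1) * η) :=
  fun b => (norm_ev_chartH_smul_lt ev hev₀ R hjc h𝔄 hτ0 hτ1 hK hT0 hT b).trans_le hsize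

/-- **(3.37) in the shape `JInputs.hKd`** — *«|∇^ξ𝐇_j(□₀, τQ(…))| < B₃²O(1)Mα₀L^{j−1}η»*. [cite: Balaban1987RG1, (3.37) p.277] -/
theorem ineq337_grad
    (hev₁ : ∀ (Y : 𝒴) (μ ν : Fin P.d) (y : Site P i), ‖grad ξ μ (fun z => ev Y ⟨z, ν⟩) y‖ ≤ ‖Y‖)
    (R : Regime 𝒢 0 W B₀ θ C₄ a₃ jc a ε₄) (hjc : 0 ≤ jc) {𝔄 : 𝒴} (h𝔄 : ‖𝔄‖ < a)
    {τ : ℝ} (hτ0 : 0 ≤ τ) (hτ1 : τ ≤ 1) {K : ℝ} (hK : 0 < K) (hT0 : T 0 = 0)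
    (hT : ∀ x y : 𝒴, ‖x‖ < ε₄ + a → ‖y‖ < ε₄ + a → ‖T x - T y‖ ≤ K * ‖x - y‖)
    {B₃ O₁ M α₀ L η : ℝ} {j : ℕ} (hsize : K * (ε₄ + a) ≤ B₃ ^ 2 * O₁ * M * α₀ * (L ^ (j - 1) * η)) :
    ∀ (μ ν : Fin P.d) (y : Site P i),
      ‖grad ξ μ (fun z => ev (chartH 𝒢 0 W 0 T ε₄ ((τ : ℂ) • 𝔄)) ⟨z, ν⟩) y‖ < B₃ ^ 2 * O₁ * M * α₀ * (L ^ (j - 1) * η) :=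
  fun μ ν y => (norm_grad_ev_chartH_smul_lt ev hev₁ R hjc h𝔄 hτ0 hτ1 hK hT0 hT μ ν y).trans_le hsize

/-- **(3.37) in the shape `JInputs.hH`** (`τ = 1`: the configuration `𝐇 = 𝐇_j(□₀, Q(L⁻¹η𝐇_{k+1}))` of (3.39)).
[cite: Balaban1987RG1, (3.37) p.277] -/
theorem ineq337_letter_one (hev₀ : ∀ (Y : 𝒴) (b : PBond P i), ‖ev Y b‖ ≤ ‖Y‖)
    (R : Regime 𝒢 0 W B₀ θ C₄ a₃ jc a ε₄) (hjc : 0 ≤ jc) {𝔄 : 𝒴} (h𝔄 : ‖𝔄‖ < a)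
    {K : ℝ} (hK : 0 < K) (hT0 : T 0 = 0)
    (hT : ∀ x y : 𝒴, ‖x‖ < ε₄ + a → ‖y‖ < ε₄ + a → ‖T x - T y‖ ≤ K * ‖x - y‖)
    {B₃ O₁ M α₀ L η : ℝ} {j : ℕ} (hsize : K * (ε₄ + a) ≤ B₃ ^ 2 * O₁ * M * α₀ * (L ^ (j - 1) * η)) :
    ∀ b : PBond P i, ‖ev (chartH 𝒢 0 W 0 T ε₄ 𝔄) b‖ < B₃ ^ 2 * O₁ * M * α₀ * (L ^ (j - 1) * η) := by
  have h := ineq337_letter ev hev₀ R hjc h𝔄 zero_le_one le_rfl hK hT0 hT hsize (τ := 1)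
  simpa using h

/-- **(3.37) in the shape `JInputs.hHd`** (`τ = 1`). [cite: Balaban1987RG1, (3.37) p.277] -/
theorem ineq337_grad_one
    (hev₁ : ∀ (Y : 𝒴) (μ ν : Fin P.d) (y : Site P i), ‖grad ξ μ (fun z => ev Y ⟨z, ν⟩) y‖ ≤ ‖Y‖)
    (R : Regime 𝒢 0 W B₀ θ C₄ a₃ jc a ε₄) (hjc : 0 ≤ jc) {𝔄 : 𝒴} (h𝔄 : ‖𝔄‖ < a)
    {K : ℝ} (hK : 0 < K) (hT0 : T 0 = 0)
    (hT : ∀ x y : 𝒴, ‖x‖ < ε₄ + a → ‖y‖ < ε₄ + a → ‖T x - T y‖ ≤ K * ‖x - y‖)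
    {B₃ O₁ M α₀ L η : ℝ} {j : ℕ} (hsize : K * (ε₄ + a) ≤ B₃ ^ 2 * O₁ * M * α₀ * (L ^ (j - 1) * η)) :
    ∀ (μ ν : Fin P.d) (y : Site P i),
      ‖grad ξ μ (fun z => ev (chartH 𝒢 0 W 0 T ε₄ 𝔄) ⟨z, ν⟩) y‖ < B₃ ^ 2 * O₁ * M * α₀ * (L ^ (j - 1) * η) := by
  have h := ineq337_grad ev hev₁ R hjc h𝔄 zero_le_one le_rfl hK hT0 hT hsize (τ := 1)
  simpa using h

omit [CompleteSpace 𝒴] in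
/-- **The datum of (3.37) from (3.27) and (97) [12]** (the two-chart composition of p. 277): the datum
`𝔄 = H_{1,j}Q(L⁻¹η·𝐇_{k+1}(□₀, (1/i) log V))` built from a second chart value `Y′` with `‖Y′‖ ≤ K′(ε₄′ + a′)` ([15] Prop. 9 for the
(k+1)-st problem, = (3.27)), a bounded averaging `Q` ((97) [12]: `‖Q‖ ≤ q`), the scale factor `c = L⁻¹η` and the linear minimiser `H₁`
((103)) has norm `≤ ‖H₁‖·q·|c|·K′(ε₄′ + a′)`; so the regime radius `a` of §2 can be any larger number.
[cite: Balaban1987RG1, (3.27) p.275, (3.37) p.277] [cite: Balaban1985Averaging, (97) p.33] -/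
theorem norm_datum_le_of_chart {𝒴' : Type*} [NormedAddCommGroup 𝒴'] [NormedSpace ℂ 𝒴'] (H₁ : 𝒳 →L[ℂ] 𝒴) (Q : 𝒴' →L[ℂ] 𝒳)
    {q : ℝ} (hQ : ‖Q‖ ≤ q) (c : ℂ) {Y' : 𝒴'} {K' ε₄' a' : ℝ} (hY' : ‖Y'‖ ≤ K' * (ε₄' + a')) :
    ‖H₁ (Q (c • Y'))‖ ≤ ‖H₁‖ * q * ‖c‖ * (K' * (ε₄' + a')) := by
  have h1 : ‖H₁ (Q (c • Y'))‖ ≤ ‖H₁‖ * ‖Q (c • Y')‖ := H₁.le_opNorm _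
  have h2 : ‖Q (c • Y')‖ ≤ ‖Q‖ * ‖c • Y'‖ := Q.le_opNorm _
  have h3 : ‖c • Y'‖ = ‖c‖ * ‖Y'‖ := norm_smul _ _
  have hH : 0 ≤ ‖H₁‖ := norm_nonneg _
  have hQ0 : 0 ≤ ‖Q‖ := norm_nonneg _
  have hc : 0 ≤ ‖c‖ := norm_nonneg _
  have hY0 : 0 ≤ ‖Y'‖ := norm_nonneg _
  have hq : 0 ≤ q := hQ0.trans hQ
  calc ‖H₁ (Q (c • Y'))‖ ≤ ‖H₁‖ * (‖Q‖ * (‖c‖ * ‖Y'‖)) := by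
        rw [← h3]; exact h1.trans (mul_le_mul_of_nonneg_left h2 hH)
    _ ≤ ‖H₁‖ * (q * (‖c‖ * (K' * (ε₄' + a')))) := by
        gcongr
    _ = ‖H₁‖ * q * ‖c‖ * (K' * (ε₄' + a')) := by ring

/-! ## §3. (3.45) p. 279: the second-order deviation of the chart from its linear term, from (177) of [15] -/

/-- **(3.45), chart form** — *«the functions on the right-hand side [of (174)] are at least of second order, except the first term.
This implies |∂^ξ𝐇_j(□₀, ·) − ∂^ξH_{1,j}·| < B₃(B₃O(1)Mα₀L^{j−1}η)²»*: with the linearisation `ℓ p := ξ⁻¹(curl of ev 𝔄 at p)` of the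
presented datum, the plaquette combination of `𝐊_τ = ev 𝓗(τ𝔄)` deviates from `τ·ℓ p` by at most `2(K_D + B₀C₄)(ε₄ + a)²`, for `T` of
second order on the ball (`‖T Y − Y‖ ≤ K_D‖Y‖²`, print's `−H_jD_j(…)`) — (177) `Regime.norm_chartH_sub_self_le` at the datum `τ𝔄` and §1.
[cite: Balaban1987RG1, (3.45) p.279] [cite: Balaban1985Variational, (177) p.306] -/
theorem norm_curl_chartH_sub_lin_le
    (hev₁ : ∀ (Y : 𝒴) (μ ν : Fin P.d) (y : Site P i), ‖grad ξ μ (fun z => ev Y ⟨z, ν⟩) y‖ ≤ ‖Y‖)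
    (R : Regime 𝒢 0 W B₀ θ C₄ a₃ jc a ε₄) (hjc : 0 ≤ jc) {𝔄 : 𝒴} (h𝔄 : ‖𝔄‖ < a)
    {τ : ℝ} (hτ0 : 0 ≤ τ) (hτ1 : τ ≤ 1) {K_D : ℝ} (hKD : 0 ≤ K_D)
    (hTD : ∀ Y : 𝒴, ‖Y‖ < ε₄ + a → ‖T Y - Y‖ ≤ K_D * ‖Y‖ ^ 2) (p : Plaq P i) :
    ‖(ξ : ℂ)⁻¹ • (ev (chartH 𝒢 0 W 0 T ε₄ ((τ : ℂ) • 𝔄)) ⟨p.src, p.μ⟩ +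
          ev (chartH 𝒢 0 W 0 T ε₄ ((τ : ℂ) • 𝔄)) ⟨p.src.shift p.μ, p.ν⟩ -
          ev (chartH 𝒢 0 W 0 T ε₄ ((τ : ℂ) • 𝔄)) ⟨p.src.shift p.ν, p.μ⟩ -
          ev (chartH 𝒢 0 W 0 T ε₄ ((τ : ℂ) • 𝔄)) ⟨p.src, p.ν⟩) -
        (τ : ℂ) • ((ξ : ℂ)⁻¹ • (ev 𝔄 ⟨p.src, p.μ⟩ + ev 𝔄 ⟨p.src.shift p.μ, p.ν⟩ - ev 𝔄 ⟨p.src.shift p.ν, p.μ⟩ -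
          ev 𝔄 ⟨p.src, p.ν⟩))‖ ≤ 2 * (K_D + B₀ * C₄) * (ε₄ + a) ^ 2 := by
  have hτ𝔄 : ‖(τ : ℂ) • 𝔄‖ < a := norm_real_smul_lt hτ0 hτ1 h𝔄
  have h177 := R.norm_chartH_sub_self_le (T := T) hjc hτ𝔄 hKD hTD
  -- the linear part is the plaquette combination of `ev (τ𝔄)`
  rw [← curl_smul ξ (τ : ℂ) (ev 𝔄) p, ← map_smul, ← curl_sub ξ _ _ p, ← map_sub]
  refine (norm_curl_ev_le ev hev₁ _ p).trans ?_
  linarith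

/-- **(3.45) in the shape `JInputs.h45τ`** — `‖ξ⁻¹(curl of 𝐊_τ at p) − τℓ p‖ < B₃(B₃O₁Mα₀(L^{j−1}η))²` on every plaquette, once
`2(K_D + B₀C₄)(ε₄ + a)² < B₃(B₃O₁Mα₀(L^{j−1}η))²` (print's constant: `ε₄ + a` is of order `B₃O(1)Mα₀·L^{j−1}η`, see `ineq337_letter`).
[cite: Balaban1987RG1, (3.45) p.279] -/
theorem ineq345_tau
    (hev₁ : ∀ (Y : 𝒴) (μ ν : Fin P.d) (y : Site P i), ‖grad ξ μ (fun z => ev Y ⟨z, ν⟩) y‖ ≤ ‖Y‖)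
    (R : Regime 𝒢 0 W B₀ θ C₄ a₃ jc a ε₄) (hjc : 0 ≤ jc) {𝔄 : 𝒴} (h𝔄 : ‖𝔄‖ < a)
    {τ : ℝ} (hτ0 : 0 ≤ τ) (hτ1 : τ ≤ 1) {K_D : ℝ} (hKD : 0 ≤ K_D)
    (hTD : ∀ Y : 𝒴, ‖Y‖ < ε₄ + a → ‖T Y - Y‖ ≤ K_D * ‖Y‖ ^ 2)
    {B₃ O₁ M α₀ L η : ℝ} {j : ℕ}
    (hsize : 2 * (K_D + B₀ * C₄) * (ε₄ + a) ^ 2 < B₃ * (B₃ * O₁ * M * α₀ * (L ^ (j - 1) * η)) ^ 2) :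
    ∀ p : Plaq P i,
      ‖(ξ : ℂ)⁻¹ • (ev (chartH 𝒢 0 W 0 T ε₄ ((τ : ℂ) • 𝔄)) ⟨p.src, p.μ⟩ +
            ev (chartH 𝒢 0 W 0 T ε₄ ((τ : ℂ) • 𝔄)) ⟨p.src.shift p.μ, p.ν⟩ -
            ev (chartH 𝒢 0 W 0 T ε₄ ((τ : ℂ) • 𝔄)) ⟨p.src.shift p.ν, p.μ⟩ -
            ev (chartH 𝒢 0 W 0 T ε₄ ((τ : ℂ) • 𝔄)) ⟨p.src, p.ν⟩) -
          (τ : ℂ) • ((ξ : ℂ)⁻¹ • (ev 𝔄 ⟨p.src, p.μ⟩ + ev 𝔄 ⟨p.src.shift p.μ, p.ν⟩ - ev 𝔄 ⟨p.src.shift p.ν, p.μ⟩ -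
            ev 𝔄 ⟨p.src, p.ν⟩))‖ < B₃ * (B₃ * O₁ * M * α₀ * (L ^ (j - 1) * η)) ^ 2 :=
  fun p => (norm_curl_chartH_sub_lin_le ev hev₁ R hjc h𝔄 hτ0 hτ1 hKD hTD p).trans_lt hsize

/-- **(3.45) in the shape `JInputs.h45`** (`τ = 1`, the literal display (3.45) for `𝐇 = 𝐇_j(□₀, Q(L⁻¹η𝐇_{k+1}))`).
[cite: Balaban1987RG1, (3.45) p.279] -/
theorem ineq345_one
    (hev₁ : ∀ (Y : 𝒴) (μ ν : Fin P.d) (y : Site P i), ‖grad ξ μ (fun z => ev Y ⟨z, ν⟩) y‖ ≤ ‖Y‖)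
    (R : Regime 𝒢 0 W B₀ θ C₄ a₃ jc a ε₄) (hjc : 0 ≤ jc) {𝔄 : 𝒴} (h𝔄 : ‖𝔄‖ < a)
    {K_D : ℝ} (hKD : 0 ≤ K_D) (hTD : ∀ Y : 𝒴, ‖Y‖ < ε₄ + a → ‖T Y - Y‖ ≤ K_D * ‖Y‖ ^ 2)
    {B₃ O₁ M α₀ L η : ℝ} {j : ℕ}
    (hsize : 2 * (K_D + B₀ * C₄) * (ε₄ + a) ^ 2 < B₃ * (B₃ * O₁ * M * α₀ * (L ^ (j - 1) * η)) ^ 2) :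
    ∀ p : Plaq P i,
      ‖(ξ : ℂ)⁻¹ • (ev (chartH 𝒢 0 W 0 T ε₄ 𝔄) ⟨p.src, p.μ⟩ + ev (chartH 𝒢 0 W 0 T ε₄ 𝔄) ⟨p.src.shift p.μ, p.ν⟩ -
            ev (chartH 𝒢 0 W 0 T ε₄ 𝔄) ⟨p.src.shift p.ν, p.μ⟩ - ev (chartH 𝒢 0 W 0 T ε₄ 𝔄) ⟨p.src, p.ν⟩) -
          (ξ : ℂ)⁻¹ • (ev 𝔄 ⟨p.src, p.μ⟩ + ev 𝔄 ⟨p.src.shift p.μ, p.ν⟩ - ev 𝔄 ⟨p.src.shift p.ν, p.μ⟩ - ev 𝔄 ⟨p.src, p.ν⟩)‖ <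
        B₃ * (B₃ * O₁ * M * α₀ * (L ^ (j - 1) * η)) ^ 2 := by
  intro p
  have h := ineq345_tau ev hev₁ R hjc h𝔄 zero_le_one le_rfl hKD hTD hsize p (τ := 1)
  simpa using h

/-! ## §4. (3.50) pp. 279–280: `𝐀₂` and its size from the Lipschitz dependence of the chart on its datum -/

omit [CompleteSpace 𝒴] in
/-- **(3.50), first display**: `𝐇_j(□₀, 𝔄₀ + 𝔄′) = 𝐇_j(□₀, 𝔄₀) + 𝐀₂` with `𝐀₂ := ev(𝓗(𝔄₀ + 𝔄′) − 𝓗(𝔄₀))` — print's definition of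
`𝐀₂` as the increment of the chart (the integral form `∫₀¹⟨(δ/δB 𝐇_j)(□₀, 𝔄₀ + t₂B′), B′⟩dt₂` is that increment by the fundamental theorem
of calculus; here only the increment is used). [cite: Balaban1987RG1, (3.50) p.279] -/
theorem eq350 (𝔄₀ 𝔄' : 𝒴) :
    ev (chartH 𝒢 0 W 0 T ε₄ (𝔄₀ + 𝔄')) =
      ev (chartH 𝒢 0 W 0 T ε₄ 𝔄₀) + ev (chartH 𝒢 0 W 0 T ε₄ (𝔄₀ + 𝔄') - chartH 𝒢 0 W 0 T ε₄ 𝔄₀) := by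
  rw [map_sub, add_sub_cancel]

/-- **(3.50), letters** — *«It implies |𝐀₂| ≤ B₃|B′|»* in chart currency: for data `𝔄₀`, `𝔄₀ + 𝔄′` in the open ball of radius `a`,
every bond value of `𝐀₂ = ev(𝓗(𝔄₀ + 𝔄′) − 𝓗(𝔄₀))` is `≤ K(κ/(1 − κ) + 1)‖𝔄′‖`, `κ = θ + 4B₀C₄(ε₄ + a)` the contraction constant (120)
(`B11Eq120SolutionLipschitz.norm_chartH_sub_chartH_le_datum`). [cite: Balaban1987RG1, (3.50) p.280] [cite: Balaban1985Variational, Prop. 6 (120) p.295] -/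
theorem norm_A2_le (hev₀ : ∀ (Y : 𝒴) (b : PBond P i), ‖ev Y b‖ ≤ ‖Y‖)
    (R : Regime 𝒢 0 W B₀ θ C₄ a₃ jc a ε₄) (hjc : 0 ≤ jc) {𝔄₀ 𝔄' : 𝒴} (h𝔄₀ : ‖𝔄₀‖ < a) (h𝔄₁ : ‖𝔄₀ + 𝔄'‖ < a)
    {K : ℝ} (hK : 0 ≤ K) (hT : ∀ x y : 𝒴, ‖x‖ < ε₄ + a → ‖y‖ < ε₄ + a → ‖T x - T y‖ ≤ K * ‖x - y‖) (b : PBond P i) :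
    ‖ev (chartH 𝒢 0 W 0 T ε₄ (𝔄₀ + 𝔄') - chartH 𝒢 0 W 0 T ε₄ 𝔄₀) b‖ ≤
      K * ((θ + 4 * B₀ * C₄ * (ε₄ + a)) / (1 - (θ + 4 * B₀ * C₄ * (ε₄ + a))) + 1) * ‖𝔄'‖ := by
  have hJ : ‖(0 : 𝒵)‖ ≤ jc := by simpa using hjc
  have h := norm_chartH_sub_chartH_le_datum (Λ := 0) (J := 0) (T := T) R hJ h𝔄₁ h𝔄₀ hK hT
  rw [add_sub_cancel_left] at h
  exact (hev₀ _ b).trans h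

/-- **(3.50), gradients** — *«|∇^ξ𝐀₂| ≤ B₃|B′|»* in chart currency. [cite: Balaban1987RG1, (3.50) p.280] -/
theorem norm_grad_A2_le
    (hev₁ : ∀ (Y : 𝒴) (μ ν : Fin P.d) (y : Site P i), ‖grad ξ μ (fun z => ev Y ⟨z, ν⟩) y‖ ≤ ‖Y‖)
    (R : Regime 𝒢 0 W B₀ θ C₄ a₃ jc a ε₄) (hjc : 0 ≤ jc) {𝔄₀ 𝔄' : 𝒴} (h𝔄₀ : ‖𝔄₀‖ < a) (h𝔄₁ : ‖𝔄₀ + 𝔄'‖ < a)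
    {K : ℝ} (hK : 0 ≤ K) (hT : ∀ x y : 𝒴, ‖x‖ < ε₄ + a → ‖y‖ < ε₄ + a → ‖T x - T y‖ ≤ K * ‖x - y‖)
    (μ ν : Fin P.d) (y : Site P i) :
    ‖grad ξ μ (fun z => ev (chartH 𝒢 0 W 0 T ε₄ (𝔄₀ + 𝔄') - chartH 𝒢 0 W 0 T ε₄ 𝔄₀) ⟨z, ν⟩) y‖ ≤
      K * ((θ + 4 * B₀ * C₄ * (ε₄ + a)) / (1 - (θ + 4 * B₀ * C₄ * (ε₄ + a))) + 1) * ‖𝔄'‖ := by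
  have hJ : ‖(0 : 𝒵)‖ ≤ jc := by simpa using hjc
  have h := norm_chartH_sub_chartH_le_datum (Λ := 0) (J := 0) (T := T) R hJ h𝔄₁ h𝔄₀ hK hT
  rw [add_sub_cancel_left] at h
  exact (hev₁ _ μ ν y).trans h

omit [CompleteSpace 𝒴] in
/-- The contraction constant `κ = θ + 4B₀C₄(ε₄ + a)` of (120) lies in `[0, 1)` under a regime (with a nonempty datum ball), so the
Lipschitz constant `K(κ/(1 − κ) + 1)` of the chart is `≥ 0`. [cite: Balaban1985Variational, (120)–(121) p.295] -/
theorem lipConst_nonneg (R : Regime 𝒢 0 W B₀ θ C₄ a₃ jc a ε₄) (ha : 0 < a) {K : ℝ} (hK : 0 ≤ K) :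
    0 ≤ K * ((θ + 4 * B₀ * C₄ * (ε₄ + a)) / (1 - (θ + 4 * B₀ * C₄ * (ε₄ + a))) + 1) := by
  have hκ1 : θ + 4 * B₀ * C₄ * (ε₄ + a) < 1 := R.contr
  have hκ0 : 0 ≤ θ + 4 * B₀ * C₄ * (ε₄ + a) := by
    have := R.θ_nonneg; have := R.B₀_nonneg; have := R.C₄_nonneg; have := R.ε₄_nonneg
    positivity
  have h1 : 0 < 1 - (θ + 4 * B₀ * C₄ * (ε₄ + a)) := by linarith
  have : 0 ≤ (θ + 4 * B₀ * C₄ * (ε₄ + a)) / (1 - (θ + 4 * B₀ * C₄ * (ε₄ + a))) := div_nonneg hκ0 h1.le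
  positivity

/-- **(3.50) in the shape `JInputs.hA`** — *«|𝐀₂| ≤ B₃|B′|»*: with the increment `𝔄′ = H₁B′` of the datum (`H₁` the linear minimiser,
a continuous linear datum), `‖B′‖ ≤ n` and the constant bookkeeping `K(κ/(1 − κ) + 1)·‖H₁‖ ≤ B₃`: `‖𝐀₂ b‖ ≤ B₃·n` on every bond.
[cite: Balaban1987RG1, (3.50) p.280] -/
theorem ineq350_letter (hev₀ : ∀ (Y : 𝒴) (b : PBond P i), ‖ev Y b‖ ≤ ‖Y‖)
    (R : Regime 𝒢 0 W B₀ θ C₄ a₃ jc a ε₄) (hjc : 0 ≤ jc) (H₁ : 𝒳 →L[ℂ] 𝒴) {𝔄₀ : 𝒴} {B' : 𝒳}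
    (h𝔄₀ : ‖𝔄₀‖ < a) (h𝔄₁ : ‖𝔄₀ + H₁ B'‖ < a)
    {K : ℝ} (hK : 0 ≤ K) (hT : ∀ x y : 𝒴, ‖x‖ < ε₄ + a → ‖y‖ < ε₄ + a → ‖T x - T y‖ ≤ K * ‖x - y‖)
    {B₃ n : ℝ} (hn : ‖B'‖ ≤ n)
    (hB₃ : K * ((θ + 4 * B₀ * C₄ * (ε₄ + a)) / (1 - (θ + 4 * B₀ * C₄ * (ε₄ + a))) + 1) * ‖H₁‖ ≤ B₃) :
    ∀ b : PBond P i, ‖ev (chartH 𝒢 0 W 0 T ε₄ (𝔄₀ + H₁ B') - chartH 𝒢 0 W 0 T ε₄ 𝔄₀) b‖ ≤ B₃ * n := by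
  intro b
  have ha : 0 < a := (norm_nonneg _).trans_lt h𝔄₀
  have hL := lipConst_nonneg R ha hK
  have h1 := norm_A2_le ev hev₀ R hjc h𝔄₀ h𝔄₁ hK hT b
  have h2 : ‖H₁ B'‖ ≤ ‖H₁‖ * ‖B'‖ := H₁.le_opNorm _
  have hB₃0 : 0 ≤ B₃ := le_trans (mul_nonneg hL (norm_nonneg _)) hB₃
  have hn0 : 0 ≤ n := (norm_nonneg _).trans hn
  calc ‖ev (chartH 𝒢 0 W 0 T ε₄ (𝔄₀ + H₁ B') - chartH 𝒢 0 W 0 T ε₄ 𝔄₀) b‖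
      ≤ K * ((θ + 4 * B₀ * C₄ * (ε₄ + a)) / (1 - (θ + 4 * B₀ * C₄ * (ε₄ + a))) + 1) * (‖H₁‖ * ‖B'‖) :=
        h1.trans (mul_le_mul_of_nonneg_left h2 hL)
    _ = (K * ((θ + 4 * B₀ * C₄ * (ε₄ + a)) / (1 - (θ + 4 * B₀ * C₄ * (ε₄ + a))) + 1) * ‖H₁‖) * ‖B'‖ := by ring
    _ ≤ B₃ * n := mul_le_mul hB₃ hn (norm_nonneg _) hB₃0

/-- **(3.50) in the shape `JInputs.hAd`** — *«|∇^ξ𝐀₂| ≤ B₃|B′|»*. [cite: Balaban1987RG1, (3.50) p.280] -/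
theorem ineq350_grad
    (hev₁ : ∀ (Y : 𝒴) (μ ν : Fin P.d) (y : Site P i), ‖grad ξ μ (fun z => ev Y ⟨z, ν⟩) y‖ ≤ ‖Y‖)
    (R : Regime 𝒢 0 W B₀ θ C₄ a₃ jc a ε₄) (hjc : 0 ≤ jc) (H₁ : 𝒳 →L[ℂ] 𝒴) {𝔄₀ : 𝒴} {B' : 𝒳}
    (h𝔄₀ : ‖𝔄₀‖ < a) (h𝔄₁ : ‖𝔄₀ + H₁ B'‖ < a)
    {K : ℝ} (hK : 0 ≤ K) (hT : ∀ x y : 𝒴, ‖x‖ < ε₄ + a → ‖y‖ < ε₄ + a → ‖T x - T y‖ ≤ K * ‖x - y‖)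
    {B₃ n : ℝ} (hn : ‖B'‖ ≤ n)
    (hB₃ : K * ((θ + 4 * B₀ * C₄ * (ε₄ + a)) / (1 - (θ + 4 * B₀ * C₄ * (ε₄ + a))) + 1) * ‖H₁‖ ≤ B₃) :
    ∀ (μ ν : Fin P.d) (y : Site P i),
      ‖grad ξ μ (fun z => ev (chartH 𝒢 0 W 0 T ε₄ (𝔄₀ + H₁ B') - chartH 𝒢 0 W 0 T ε₄ 𝔄₀) ⟨z, ν⟩) y‖ ≤ B₃ * n := by
  intro μ ν y
  have ha : 0 < a := (norm_nonneg _).trans_lt h𝔄₀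
  have hL := lipConst_nonneg R ha hK
  have h1 := norm_grad_A2_le ev hev₁ R hjc h𝔄₀ h𝔄₁ hK hT μ ν y
  have h2 : ‖H₁ B'‖ ≤ ‖H₁‖ * ‖B'‖ := H₁.le_opNorm _
  have hB₃0 : 0 ≤ B₃ := le_trans (mul_nonneg hL (norm_nonneg _)) hB₃
  calc ‖grad ξ μ (fun z => ev (chartH 𝒢 0 W 0 T ε₄ (𝔄₀ + H₁ B') - chartH 𝒢 0 W 0 T ε₄ 𝔄₀) ⟨z, ν⟩) y‖
      ≤ K * ((θ + 4 * B₀ * C₄ * (ε₄ + a)) / (1 - (θ + 4 * B₀ * C₄ * (ε₄ + a))) + 1) * (‖H₁‖ * ‖B'‖) :=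
        h1.trans (mul_le_mul_of_nonneg_left h2 hL)
    _ = (K * ((θ + 4 * B₀ * C₄ * (ε₄ + a)) / (1 - (θ + 4 * B₀ * C₄ * (ε₄ + a))) + 1) * ‖H₁‖) * ‖B'‖ := by ring
    _ ≤ B₃ * n := mul_le_mul hB₃ hn (norm_nonneg _) hB₃0

end Chart

/-! ## §5. (v2) Localised presentations: domination on a bond set `S` and a site set `S₀` only

For the genuine space (115) of [15] (`B11Eq115Space`: the norm is `max{|·|_{(−1)}, |∇·|_{(−2)}}` with the level weights
`(L^nξ)`, `(L^nξ)²`), a letter or a `ξ`-gradient is dominated by the norm with constant `1` exactly on the TOP level (weight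
`L^jξ = 1`), i.e. on the region of (3.37) *«on □̃³»* — not on the lower-level boundary layers of `□₀`.  The theorems of §§2–4 are
therefore repeated with the domination hypotheses, and the conclusions, restricted to a set `S` of bonds (letters) and a set `S₀` of
sites (gradients; plaquettes through their base point). -/

section ChartOn

variable [CompleteSpace 𝒴] {𝒢 : 𝒵 →L[ℂ] 𝒴} {W : 𝒴 → 𝒵} {T : 𝒴 → 𝒴} {B₀ θ C₄ a₃ jc a ε₄ : ℝ}
variable (ev : 𝒴 →ₗ[ℂ] (PBond P i → 𝔸)) {ξ : ℝ} {S : Set (PBond P i)} {S₀ : Set (Site P i)}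

omit [CompleteSpace 𝒴] in
/-- Localised form of the plaquette-combination domination: at a plaquette whose base point lies in `S₀`. [folklore] -/
private theorem norm_curl_ev_le_on
    (hev₁ : ∀ (Y : 𝒴) (μ ν : Fin P.d), ∀ y ∈ S₀, ‖grad ξ μ (fun z => ev Y ⟨z, ν⟩) y‖ ≤ ‖Y‖) (Y : 𝒴) {p : Plaq P i}
    (hp : p.src ∈ S₀) :
    ‖(ξ : ℂ)⁻¹ • (ev Y ⟨p.src, p.μ⟩ + ev Y ⟨p.src.shift p.μ, p.ν⟩ - ev Y ⟨p.src.shift p.ν, p.μ⟩ - ev Y ⟨p.src, p.ν⟩)‖ ≤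
      2 * ‖Y‖ := by
  rw [curl_eq_grad_sub]
  refine (norm_sub_le _ _).trans ?_
  have h1 := hev₁ Y p.μ p.ν p.src hp
  have h2 := hev₁ Y p.ν p.μ p.src hp
  linarith

/-- **(3.37) on a bond set** (shape `JInputs.hK` restricted to `S`, print's *«on □̃³»*): `‖𝐊_τ b‖ < B₃²O₁Mα₀(L^{j−1}η)` for `b ∈ S`
when the presentation dominates letters on `S`. [cite: Balaban1987RG1, (3.37) p.277] -/
theorem ineq337_letter_on (hev₀ : ∀ (Y : 𝒴), ∀ b ∈ S, ‖ev Y b‖ ≤ ‖Y‖)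
    (R : Regime 𝒢 0 W B₀ θ C₄ a₃ jc a ε₄) (hjc : 0 ≤ jc) {𝔄 : 𝒴} (h𝔄 : ‖𝔄‖ < a)
    {τ : ℝ} (hτ0 : 0 ≤ τ) (hτ1 : τ ≤ 1) {K : ℝ} (hK : 0 < K) (hT0 : T 0 = 0)
    (hT : ∀ x y : 𝒴, ‖x‖ < ε₄ + a → ‖y‖ < ε₄ + a → ‖T x - T y‖ ≤ K * ‖x - y‖)
    {B₃ O₁ M α₀ L η : ℝ} {j : ℕ} (hsize : K * (ε₄ + a) ≤ B₃ ^ 2 * O₁ * M * α₀ * (L ^ (j - 1) * η)) :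
    ∀ b ∈ S, ‖ev (chartH 𝒢 0 W 0 T ε₄ ((τ : ℂ) • 𝔄)) b‖ < B₃ ^ 2 * O₁ * M * α₀ * (L ^ (j - 1) * η) :=
  fun b hb => ((hev₀ _ b hb).trans_lt (norm_chartH_smul_lt R hjc h𝔄 hτ0 hτ1 hK hT0 hT)).trans_le hsize

/-- **(3.37) gradients on a site set** (shape `JInputs.hKd` restricted to `S₀`). [cite: Balaban1987RG1, (3.37) p.277] -/
theorem ineq337_grad_on
    (hev₁ : ∀ (Y : 𝒴) (μ ν : Fin P.d), ∀ y ∈ S₀, ‖grad ξ μ (fun z => ev Y ⟨z, ν⟩) y‖ ≤ ‖Y‖)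
    (R : Regime 𝒢 0 W B₀ θ C₄ a₃ jc a ε₄) (hjc : 0 ≤ jc) {𝔄 : 𝒴} (h𝔄 : ‖𝔄‖ < a)
    {τ : ℝ} (hτ0 : 0 ≤ τ) (hτ1 : τ ≤ 1) {K : ℝ} (hK : 0 < K) (hT0 : T 0 = 0)
    (hT : ∀ x y : 𝒴, ‖x‖ < ε₄ + a → ‖y‖ < ε₄ + a → ‖T x - T y‖ ≤ K * ‖x - y‖)
    {B₃ O₁ M α₀ L η : ℝ} {j : ℕ} (hsize : K * (ε₄ + a) ≤ B₃ ^ 2 * O₁ * M * α₀ * (L ^ (j - 1) * η)) :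
    ∀ (μ ν : Fin P.d), ∀ y ∈ S₀,
      ‖grad ξ μ (fun z => ev (chartH 𝒢 0 W 0 T ε₄ ((τ : ℂ) • 𝔄)) ⟨z, ν⟩) y‖ < B₃ ^ 2 * O₁ * M * α₀ * (L ^ (j - 1) * η) :=
  fun μ ν y hy => ((hev₁ _ μ ν y hy).trans_lt (norm_chartH_smul_lt R hjc h𝔄 hτ0 hτ1 hK hT0 hT)).trans_le hsize

/-- **(3.37) letters on a bond set, `τ = 1`** (shape `JInputs.hH` restricted to `S`). [cite: Balaban1987RG1, (3.37) p.277] -/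
theorem ineq337_letter_one_on (hev₀ : ∀ (Y : 𝒴), ∀ b ∈ S, ‖ev Y b‖ ≤ ‖Y‖)
    (R : Regime 𝒢 0 W B₀ θ C₄ a₃ jc a ε₄) (hjc : 0 ≤ jc) {𝔄 : 𝒴} (h𝔄 : ‖𝔄‖ < a)
    {K : ℝ} (hK : 0 < K) (hT0 : T 0 = 0)
    (hT : ∀ x y : 𝒴, ‖x‖ < ε₄ + a → ‖y‖ < ε₄ + a → ‖T x - T y‖ ≤ K * ‖x - y‖)
    {B₃ O₁ M α₀ L η : ℝ} {j : ℕ} (hsize : K * (ε₄ + a) ≤ B₃ ^ 2 * O₁ * M * α₀ * (L ^ (j - 1) * η)) :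
    ∀ b ∈ S, ‖ev (chartH 𝒢 0 W 0 T ε₄ 𝔄) b‖ < B₃ ^ 2 * O₁ * M * α₀ * (L ^ (j - 1) * η) := by
  have h := ineq337_letter_on ev hev₀ R hjc h𝔄 zero_le_one le_rfl hK hT0 hT hsize (τ := 1)
  simpa using h

/-- **(3.37) gradients on a site set, `τ = 1`** (shape `JInputs.hHd` restricted to `S₀`). [cite: Balaban1987RG1, (3.37) p.277] -/
theorem ineq337_grad_one_on
    (hev₁ : ∀ (Y : 𝒴) (μ ν : Fin P.d), ∀ y ∈ S₀, ‖grad ξ μ (fun z => ev Y ⟨z, ν⟩) y‖ ≤ ‖Y‖)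
    (R : Regime 𝒢 0 W B₀ θ C₄ a₃ jc a ε₄) (hjc : 0 ≤ jc) {𝔄 : 𝒴} (h𝔄 : ‖𝔄‖ < a)
    {K : ℝ} (hK : 0 < K) (hT0 : T 0 = 0)
    (hT : ∀ x y : 𝒴, ‖x‖ < ε₄ + a → ‖y‖ < ε₄ + a → ‖T x - T y‖ ≤ K * ‖x - y‖)
    {B₃ O₁ M α₀ L η : ℝ} {j : ℕ} (hsize : K * (ε₄ + a) ≤ B₃ ^ 2 * O₁ * M * α₀ * (L ^ (j - 1) * η)) :
    ∀ (μ ν : Fin P.d), ∀ y ∈ S₀,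
      ‖grad ξ μ (fun z => ev (chartH 𝒢 0 W 0 T ε₄ 𝔄) ⟨z, ν⟩) y‖ < B₃ ^ 2 * O₁ * M * α₀ * (L ^ (j - 1) * η) := by
  have h := ineq337_grad_on ev hev₁ R hjc h𝔄 zero_le_one le_rfl hK hT0 hT hsize (τ := 1)
  simpa using h

/-- **(3.45) at plaquettes based in a site set** (shape `JInputs.h45τ` for `p` with `p.src ∈ S₀`; `JInputs` asks it on `X`'s plaquettes).
[cite: Balaban1987RG1, (3.45) p.279] -/
theorem ineq345_tau_on
    (hev₁ : ∀ (Y : 𝒴) (μ ν : Fin P.d), ∀ y ∈ S₀, ‖grad ξ μ (fun z => ev Y ⟨z, ν⟩) y‖ ≤ ‖Y‖)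
    (R : Regime 𝒢 0 W B₀ θ C₄ a₃ jc a ε₄) (hjc : 0 ≤ jc) {𝔄 : 𝒴} (h𝔄 : ‖𝔄‖ < a)
    {τ : ℝ} (hτ0 : 0 ≤ τ) (hτ1 : τ ≤ 1) {K_D : ℝ} (hKD : 0 ≤ K_D)
    (hTD : ∀ Y : 𝒴, ‖Y‖ < ε₄ + a → ‖T Y - Y‖ ≤ K_D * ‖Y‖ ^ 2)
    {B₃ O₁ M α₀ L η : ℝ} {j : ℕ}
    (hsize : 2 * (K_D + B₀ * C₄) * (ε₄ + a) ^ 2 < B₃ * (B₃ * O₁ * M * α₀ * (L ^ (j - 1) * η)) ^ 2) :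
    ∀ p : Plaq P i, p.src ∈ S₀ →
      ‖(ξ : ℂ)⁻¹ • (ev (chartH 𝒢 0 W 0 T ε₄ ((τ : ℂ) • 𝔄)) ⟨p.src, p.μ⟩ +
            ev (chartH 𝒢 0 W 0 T ε₄ ((τ : ℂ) • 𝔄)) ⟨p.src.shift p.μ, p.ν⟩ -
            ev (chartH 𝒢 0 W 0 T ε₄ ((τ : ℂ) • 𝔄)) ⟨p.src.shift p.ν, p.μ⟩ -
            ev (chartH 𝒢 0 W 0 T ε₄ ((τ : ℂ) • 𝔄)) ⟨p.src, p.ν⟩) -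
          (τ : ℂ) • ((ξ : ℂ)⁻¹ • (ev 𝔄 ⟨p.src, p.μ⟩ + ev 𝔄 ⟨p.src.shift p.μ, p.ν⟩ - ev 𝔄 ⟨p.src.shift p.ν, p.μ⟩ -
            ev 𝔄 ⟨p.src, p.ν⟩))‖ < B₃ * (B₃ * O₁ * M * α₀ * (L ^ (j - 1) * η)) ^ 2 := by
  intro p hp
  have hτ𝔄 : ‖(τ : ℂ) • 𝔄‖ < a := norm_real_smul_lt hτ0 hτ1 h𝔄
  have h177 := R.norm_chartH_sub_self_le (T := T) hjc hτ𝔄 hKD hTD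
  rw [← curl_smul ξ (τ : ℂ) (ev 𝔄) p, ← map_smul, ← curl_sub ξ _ _ p, ← map_sub]
  refine (norm_curl_ev_le_on ev hev₁ _ hp).trans_lt ?_
  linarith

/-- **(3.45) at plaquettes based in a site set, `τ = 1`** (shape `JInputs.h45`). [cite: Balaban1987RG1, (3.45) p.279] -/
theorem ineq345_one_on
    (hev₁ : ∀ (Y : 𝒴) (μ ν : Fin P.d), ∀ y ∈ S₀, ‖grad ξ μ (fun z => ev Y ⟨z, ν⟩) y‖ ≤ ‖Y‖)
    (R : Regime 𝒢 0 W B₀ θ C₄ a₃ jc a ε₄) (hjc : 0 ≤ jc) {𝔄 : 𝒴} (h𝔄 : ‖𝔄‖ < a)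
    {K_D : ℝ} (hKD : 0 ≤ K_D) (hTD : ∀ Y : 𝒴, ‖Y‖ < ε₄ + a → ‖T Y - Y‖ ≤ K_D * ‖Y‖ ^ 2)
    {B₃ O₁ M α₀ L η : ℝ} {j : ℕ}
    (hsize : 2 * (K_D + B₀ * C₄) * (ε₄ + a) ^ 2 < B₃ * (B₃ * O₁ * M * α₀ * (L ^ (j - 1) * η)) ^ 2) :
    ∀ p : Plaq P i, p.src ∈ S₀ →
      ‖(ξ : ℂ)⁻¹ • (ev (chartH 𝒢 0 W 0 T ε₄ 𝔄) ⟨p.src, p.μ⟩ + ev (chartH 𝒢 0 W 0 T ε₄ 𝔄) ⟨p.src.shift p.μ, p.ν⟩ -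
            ev (chartH 𝒢 0 W 0 T ε₄ 𝔄) ⟨p.src.shift p.ν, p.μ⟩ - ev (chartH 𝒢 0 W 0 T ε₄ 𝔄) ⟨p.src, p.ν⟩) -
          (ξ : ℂ)⁻¹ • (ev 𝔄 ⟨p.src, p.μ⟩ + ev 𝔄 ⟨p.src.shift p.μ, p.ν⟩ - ev 𝔄 ⟨p.src.shift p.ν, p.μ⟩ - ev 𝔄 ⟨p.src, p.ν⟩)‖ <
        B₃ * (B₃ * O₁ * M * α₀ * (L ^ (j - 1) * η)) ^ 2 := by
  intro p hp
  have h := ineq345_tau_on ev hev₁ R hjc h𝔄 zero_le_one le_rfl hKD hTD hsize p hp (τ := 1)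
  simpa using h

/-- **(3.50) letters on a bond set** (shape `JInputs.hA` restricted to `S`). [cite: Balaban1987RG1, (3.50) p.280] -/
theorem ineq350_letter_on (hev₀ : ∀ (Y : 𝒴), ∀ b ∈ S, ‖ev Y b‖ ≤ ‖Y‖)
    (R : Regime 𝒢 0 W B₀ θ C₄ a₃ jc a ε₄) (hjc : 0 ≤ jc) (H₁ : 𝒳 →L[ℂ] 𝒴) {𝔄₀ : 𝒴} {B' : 𝒳}
    (h𝔄₀ : ‖𝔄₀‖ < a) (h𝔄₁ : ‖𝔄₀ + H₁ B'‖ < a)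
    {K : ℝ} (hK : 0 ≤ K) (hT : ∀ x y : 𝒴, ‖x‖ < ε₄ + a → ‖y‖ < ε₄ + a → ‖T x - T y‖ ≤ K * ‖x - y‖)
    {B₃ n : ℝ} (hn : ‖B'‖ ≤ n)
    (hB₃ : K * ((θ + 4 * B₀ * C₄ * (ε₄ + a)) / (1 - (θ + 4 * B₀ * C₄ * (ε₄ + a))) + 1) * ‖H₁‖ ≤ B₃) :
    ∀ b ∈ S, ‖ev (chartH 𝒢 0 W 0 T ε₄ (𝔄₀ + H₁ B') - chartH 𝒢 0 W 0 T ε₄ 𝔄₀) b‖ ≤ B₃ * n := by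
  intro b hb
  have ha : 0 < a := (norm_nonneg _).trans_lt h𝔄₀
  have hL := lipConst_nonneg R ha hK
  have hJ : ‖(0 : 𝒵)‖ ≤ jc := by simpa using hjc
  have h := norm_chartH_sub_chartH_le_datum (Λ := 0) (J := 0) (T := T) R hJ h𝔄₁ h𝔄₀ hK hT
  rw [add_sub_cancel_left] at h
  have h1 := (hev₀ _ b hb).trans h
  have h2 : ‖H₁ B'‖ ≤ ‖H₁‖ * ‖B'‖ := H₁.le_opNorm _
  have hB₃0 : 0 ≤ B₃ := le_trans (mul_nonneg hL (norm_nonneg _)) hB₃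
  calc ‖ev (chartH 𝒢 0 W 0 T ε₄ (𝔄₀ + H₁ B') - chartH 𝒢 0 W 0 T ε₄ 𝔄₀) b‖
      ≤ K * ((θ + 4 * B₀ * C₄ * (ε₄ + a)) / (1 - (θ + 4 * B₀ * C₄ * (ε₄ + a))) + 1) * (‖H₁‖ * ‖B'‖) :=
        h1.trans (mul_le_mul_of_nonneg_left h2 hL)
    _ = (K * ((θ + 4 * B₀ * C₄ * (ε₄ + a)) / (1 - (θ + 4 * B₀ * C₄ * (ε₄ + a))) + 1) * ‖H₁‖) * ‖B'‖ := by ring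
    _ ≤ B₃ * n := mul_le_mul hB₃ hn (norm_nonneg _) hB₃0

/-- **(3.50) gradients on a site set** (shape `JInputs.hAd` restricted to `S₀`). [cite: Balaban1987RG1, (3.50) p.280] -/
theorem ineq350_grad_on
    (hev₁ : ∀ (Y : 𝒴) (μ ν : Fin P.d), ∀ y ∈ S₀, ‖grad ξ μ (fun z => ev Y ⟨z, ν⟩) y‖ ≤ ‖Y‖)
    (R : Regime 𝒢 0 W B₀ θ C₄ a₃ jc a ε₄) (hjc : 0 ≤ jc) (H₁ : 𝒳 →L[ℂ] 𝒴) {𝔄₀ : 𝒴} {B' : 𝒳}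
    (h𝔄₀ : ‖𝔄₀‖ < a) (h𝔄₁ : ‖𝔄₀ + H₁ B'‖ < a)
    {K : ℝ} (hK : 0 ≤ K) (hT : ∀ x y : 𝒴, ‖x‖ < ε₄ + a → ‖y‖ < ε₄ + a → ‖T x - T y‖ ≤ K * ‖x - y‖)
    {B₃ n : ℝ} (hn : ‖B'‖ ≤ n)
    (hB₃ : K * ((θ + 4 * B₀ * C₄ * (ε₄ + a)) / (1 - (θ + 4 * B₀ * C₄ * (ε₄ + a))) + 1) * ‖H₁‖ ≤ B₃) :
    ∀ (μ ν : Fin P.d), ∀ y ∈ S₀,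
      ‖grad ξ μ (fun z => ev (chartH 𝒢 0 W 0 T ε₄ (𝔄₀ + H₁ B') - chartH 𝒢 0 W 0 T ε₄ 𝔄₀) ⟨z, ν⟩) y‖ ≤ B₃ * n := by
  intro μ ν y hy
  have ha : 0 < a := (norm_nonneg _).trans_lt h𝔄₀
  have hL := lipConst_nonneg R ha hK
  have hJ : ‖(0 : 𝒵)‖ ≤ jc := by simpa using hjc
  have h := norm_chartH_sub_chartH_le_datum (Λ := 0) (J := 0) (T := T) R hJ h𝔄₁ h𝔄₀ hK hT
  rw [add_sub_cancel_left] at h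
  have h1 := (hev₁ _ μ ν y hy).trans h
  have h2 : ‖H₁ B'‖ ≤ ‖H₁‖ * ‖B'‖ := H₁.le_opNorm _
  have hB₃0 : 0 ≤ B₃ := le_trans (mul_nonneg hL (norm_nonneg _)) hB₃
  calc ‖grad ξ μ (fun z => ev (chartH 𝒢 0 W 0 T ε₄ (𝔄₀ + H₁ B') - chartH 𝒢 0 W 0 T ε₄ 𝔄₀) ⟨z, ν⟩) y‖
      ≤ K * ((θ + 4 * B₀ * C₄ * (ε₄ + a)) / (1 - (θ + 4 * B₀ * C₄ * (ε₄ + a))) + 1) * (‖H₁‖ * ‖B'‖) :=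
        h1.trans (mul_le_mul_of_nonneg_left h2 hL)
    _ = (K * ((θ + 4 * B₀ * C₄ * (ε₄ + a)) / (1 - (θ + 4 * B₀ * C₄ * (ε₄ + a))) + 1) * ‖H₁‖) * ‖B'‖ := by ring
    _ ≤ B₃ * n := mul_le_mul hB₃ hn (norm_nonneg _) hB₃0

end ChartOn

/-! ## §6. (v2) The presentation of record: the jet space of (115) (`B11Eq115Space.JetSup`) read as bond functions

The localised domination hypotheses of §5 HOLD for the tree's genuine (115)-type space: `𝒴 := JetSup w₀ w₁ D` on `ι := PBond P i` with
the derivative `D F (μ, ν, y) = ∇^ξ_μ F(·, ν)(y)` (the plain gradient — the background of the `j`-th problem on `□₀` in Lemma 4 is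
`U_j(□₀, 1)`, [15] Prop. 9 at `V₀ = 1`, so the covariant derivative of (115) is the plain one) and ANY positive weights that are `≥ 1` on
`S` / `S₀` (print: `w₀ = (L^{n}ξ)`, `w₁ = (L^{n}ξ)²` at level `n`, `= 1` on the top level `n = j`, `L^jξ = 1` — `B11Eq115Space.levWeight`),
presented by the reading map `Y ↦ (b ↦ Y b)` (the linear identification `NegSup.linearEquiv ∘ JetSup.fstCLM`). -/

section Jet

variable {ξ : ℝ} {w₀ : PBond P i → ℝ} {w₁ : Fin P.d × Fin P.d × Site P i → ℝ} [Fact (∀ b, 0 < w₀ b)] [Fact (∀ k, 0 < w₁ k)]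
  {D : (PBond P i → 𝔸) →ₗ[ℂ] (Fin P.d × Fin P.d × Site P i → 𝔸)}

/-- The reading map of the jet space evaluates to the underlying bond function. [cite: Balaban1985Variational, (115) p.294] -/
theorem jetRead_apply (Y : B11Eq115Space.JetSup w₀ w₁ D) (b : PBond P i) :
    ((B11Eq115Space.NegSup.linearEquiv ℂ w₀ : B11Eq115Space.NegSup w₀ 𝔸 ≃ₗ[ℂ] (PBond P i → 𝔸)).toLinearMap.comp
        (B11Eq115Space.JetSup.fstCLM w₀ w₁ D).toLinearMap) Y b = B11Eq115Space.JetSup.equiv w₀ w₁ D Y b := rfl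

/-- **Letters of the (115)-space are dominated by the norm where the weight is `≥ 1`** (the top level, print's *«on □̃³»*):
`‖Y b‖ ≤ ‖Y‖` for `b ∈ S` if `w₀ ≥ 1` on `S` — the hypothesis `hev₀` of §5 for the reading map.
[cite: Balaban1985Variational, (115) p.294] [cite: Balaban1987RG1, (3.37) p.277] -/
theorem jet_letter_dominated_on {S : Set (PBond P i)} (hw₀ : ∀ b ∈ S, 1 ≤ w₀ b) :
    ∀ (Y : B11Eq115Space.JetSup w₀ w₁ D), ∀ b ∈ S,
      ‖((B11Eq115Space.NegSup.linearEquiv ℂ w₀ : B11Eq115Space.NegSup w₀ 𝔸 ≃ₗ[ℂ] (PBond P i → 𝔸)).toLinearMap.comp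
          (B11Eq115Space.JetSup.fstCLM w₀ w₁ D).toLinearMap) Y b‖ ≤ ‖Y‖ := by
  intro Y b hb
  rw [jetRead_apply]
  have h := B11Eq115Space.JetSup.weight_mul_norm_apply_le Y b
  have h0 : 0 ≤ ‖B11Eq115Space.JetSup.equiv w₀ w₁ D Y b‖ := norm_nonneg _
  nlinarith [hw₀ b hb]

/-- **`ξ`-gradients of the (115)-space are dominated by the norm where the weight is `≥ 1`**: for the derivative letter
`D F (μ, ν, y) = ∇^ξ_μ F(·, ν)(y)` and `w₁ ≥ 1` at `(μ, ν, y)`, `y ∈ S₀`: `‖∇^ξ_μ (Y)(·, ν)(y)‖ ≤ ‖Y‖` — the hypothesis `hev₁` of §5.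
[cite: Balaban1985Variational, (115) p.294] [cite: Balaban1987RG1, (3.37) p.277] -/
theorem jet_grad_dominated_on {S₀ : Set (Site P i)}
    (hD : ∀ (F : PBond P i → 𝔸) (μ ν : Fin P.d) (y : Site P i), D F (μ, ν, y) = grad ξ μ (fun z => F ⟨z, ν⟩) y)
    (hw₁ : ∀ (μ ν : Fin P.d), ∀ y ∈ S₀, 1 ≤ w₁ (μ, ν, y)) :
    ∀ (Y : B11Eq115Space.JetSup w₀ w₁ D) (μ ν : Fin P.d), ∀ y ∈ S₀,
      ‖grad ξ μ (fun z => ((B11Eq115Space.NegSup.linearEquiv ℂ w₀ :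
          B11Eq115Space.NegSup w₀ 𝔸 ≃ₗ[ℂ] (PBond P i → 𝔸)).toLinearMap.comp
          (B11Eq115Space.JetSup.fstCLM w₀ w₁ D).toLinearMap) Y ⟨z, ν⟩) y‖ ≤ ‖Y‖ := by
  intro Y μ ν y hy
  have hfun : (fun z => ((B11Eq115Space.NegSup.linearEquiv ℂ w₀ :
          B11Eq115Space.NegSup w₀ 𝔸 ≃ₗ[ℂ] (PBond P i → 𝔸)).toLinearMap.comp
          (B11Eq115Space.JetSup.fstCLM w₀ w₁ D).toLinearMap) Y ⟨z, ν⟩) =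
      fun z => B11Eq115Space.JetSup.equiv w₀ w₁ D Y ⟨z, ν⟩ := rfl
  rw [hfun, ← hD]
  have h := B11Eq115Space.JetSup.weight_mul_norm_deriv_le Y (μ, ν, y)
  have h0 : 0 ≤ ‖D (B11Eq115Space.JetSup.equiv w₀ w₁ D Y) (μ, ν, y)‖ := norm_nonneg _
  nlinarith [hw₁ μ ν y hy]

/-- At the top level the printed weights ARE `1`: `(L^jξ)^n = 1` when `L^jξ = 1` (`B11Eq115Space.levWeight` at a point of level `j`).
[cite: Balaban1985Variational, (115) p.294, p.286] -/
theorem levWeight_eq_one_of_top {ι : Type*} {L ξ' : ℝ} {lev : ι → ℕ} {n j : ℕ} (hLξ : L ^ j * ξ' = 1) {x : ι}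
    (hx : lev x = j) : B11Eq115Space.levWeight L ξ' lev n x = 1 := by
  rw [B11Eq115Space.levWeight_apply, hx, hLξ, one_pow]

end Jet

end Literature.MathematicalPhysics.QuantumFieldTheory.Balaban1983to89.B12Lemma4ChartSizes
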